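import Summits.BirchSwinnertonDyer.Rank1Residual.Additive.GordCycLowerBoundOfControl
import Summits.BirchSwinnertonDyer.Rank1Residual.Additive.X4RankZeroCoveredLocus
import Summits.BirchSwinnertonDyer.Rank1Residual.Additive.X4RankZeroCoveredLocusManinFree
import Summits.BirchSwinnertonDyer.Rank1Residual.AdditivePotMult.LocalTowerKernelAtPPotMult
import Summits.BirchSwinnertonDyer.Rank1Residual.AdditivePotMult.RankZeroChiBranchPrimeFacts
import HarnessLib

/-!
# `BSD(E,p)` on rank-`0` X4♯(G-ord) rows at EVERY ODD `p` from the ONE typed lower input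
# `CycLowerBoundAt` and the covered-locus upper half (team n1011, row T-CTL-EC, seat p06 GEN 9,
# FILE 3 — ENDs over FILE 2; the (M) twins join this file when T-T3M's `v ∋ p` socket lands)

HONEST FRAMING (cell `b2b-bsdres-*`, team n1011, verbatim): prove what is provable now; shrink each
hard class to its core with data; no claim beyond stated classes. Research route on
CONSTRUCTION-SHAPED X4 / §I N10–N11; CONSUMER theorems only — no definition, no named fact, nothing
booked, no residual-map mark moved, no class closed; the typed input `CycLowerBoundAt` stays OPEN.

## What

`X4RankZero.bsdp_of_facts_of_lower` (additive-p4, `Additive/X4RankZeroCoveredLocus`) gives `BSD(E,p)`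
on X4 ∧ `r_an = 0` ∧ `ρ̄_{E,p}` onto ∧ COVERED LOCUS [`ord_p j < 0` ∨ (`p`-adic tower onto ∧
`ord_p ∏ c_ℓ = ord_p c_p` ∧ a Manin datum)] at EVERY odd `p`, from five PRINTED facts (`hKatoS`,
`hDel98`, `hmodD`, `hL20`, `hKatoχ`) + GZK + modularity, GIVEN the lower half `MissingLowerBoundAt W p`.
FILE 2 (`Additive/GordCycLowerBoundOfControl`) supplies that lower half on X4♯(G-ord) rank-`0` rows
from the typed input `CycLowerBoundAt W p Dh` by control alone (every bad `v ∤ p` by the numeric test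
`p ∤ c_ℓ · #Ẽ_ns(𝔽_ℓ)`; the `v = p` socket by T-T3B F7; NO Delbourgo 2002, NO Schneider, NO `¬CM`,
NO non-anomalous clause). Composition:

* `ClassX4Gord.bsdp_rankZero_of_facts_of_cycLowerBound` — **X4♯(G-ord) ∩ covered locus, `r_an = 0`,
  `ρ̄` onto, EVERY odd `p` (incl. `p = 3`, the S8-socket rows of ROUTE-2 §II.35): `BSDp W p`** from the
  five printed facts, GZK, modularity, census place data and `CycLowerBoundAt W p Dh`;
* `ClassX4Gord.bsdp_rankZero_of_factsManinFree_of_cycLowerBound` — **X4♯(G-ord), `r_an = 0`, `ρ̄` onto,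
  `p ≥ 5`, `p ∤ ∏ c_ℓ`: `BSDp W p`** with the Manin-free `p ≥ 5` upper half of additive-p4
  (`X4RankZero.missingUpperBoundAt_of_facts_of_five_le_maninFree`: no tower / Manin certificate).

Axioms standard. References: [Kato2004Asterisque] Thm. 14.5 (3), 17.4 (3); [Delbourgo1998] Prop. 4;
[Wuthrich2014] Lemma 20, Cor. 19; [GreenbergLNM1716] §3 Prop. 3.8, §4 Thm. 4.1; [Miller2011LMS]
Def. 1.1; cells/n1011/skel/T-CTL-EC.md; cells/n1011/ROUTE-2.md §II.35 (placement).
-/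

noncomputable section

open scoped Classical NumberField

open WeierstrassCurve NumberField Literature.NumberTheory.EllipticCurves
  Literature.NumberTheory.EllipticCurves.ModularForms
  Literature.NumberTheory.EllipticCurves.Rank1Residual
  Literature.NumberTheory.EllipticCurves.Rank1Residual.Typed
  IsDedekindDomain Rat.HeightOneSpectrum Summit.BirchSwinnertonDyer.Rank1Residual.Iwasawa

namespace Summit.BirchSwinnertonDyer.Rank1Residual.Additive

variable {W : WeierstrassCurve ℚ} [W.IsElliptic] [W.IsGloballyMinimal] {p : ℕ} [hp : Fact p.Prime]

/-- **X4♯(G-ord) ∩ covered locus, `r_an = 0`, `ρ̄_{E,p}` onto, EVERY odd `p`: `BSD(E,p)` from five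
PRINTED facts, GZK, modularity, census place data and the ONE typed input `CycLowerBoundAt W p Dh`.**
The covered-locus datum `hcov` is additive-p4's verbatim (on (G-ord) rows `ord_p j ≥ 0`, so it is the
second disjunct: tower onto ∧ `ord_p ∏ c_ℓ = ord_p c_p` ∧ Manin datum — per-row kernel certificates /
EVIDENCE binders as in the records files). The lower half is FILE 2's all-numeric END. X4 stays
CONSTRUCTION-SHAPED (the typed input is OPEN); nothing booked.
[cite: Kato2004Asterisque, Thm. 14.5 (3) (p. 236)] [cite: Delbourgo1998, Prop. 4 (p. 144)]
[cite: GreenbergLNM1716, §3 Prop. 3.8 (pp. 95–96) and §4 Thm. 4.1 (pp. 102–104)] [cite: Miller2011LMS, Def. 1.1] -/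
theorem ClassX4Gord.bsdp_rankZero_of_facts_of_cycLowerBound
    (hKatoS : Kato2004.rankZero_padicValNat_sha_le_sub_localTamagawa_of_additive_potGood_of_imageContainsSL2)
    (hDel98 : Delbourgo1998.prop4_rankZero_pow_dvd_constantCoeff)
    (hGZK : rank_eq_analyticRank_of_analyticRank_le_one) (hmod : hasEntireLFunction_rat)
    (hmodD : nonempty_modularParametrizationData)
    (hL20 : Wuthrich2014.lemma20_surjective_threeAdic_of_semistable)
    (hKatoχ : Wuthrich2014.kato_halfEigenCharIdeal_dvd_cyclotomicPrime_of_surjective)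
    (hX : ClassX4Gord W p) (hr : W.analyticRank = 0) (hsurj : Surj W p)
    (hcov : padicValRat p W.j < 0 ∨
      ((∀ n : ℕ, W.HasSurjectiveModNGaloisRep (p ^ n : ℕ)) ∧
        padicValNat p W.tamagawaProduct =
          padicValNat p ((W.baseChange ℚ_[p]).localTamagawaNumber ℤ_[p]) ∧
        ∃ (N : ℕ) (_ : NeZero N) (D : ModularParametrizationData W N), ¬ (p : ℤ) ∣ D.maninConstant))
    (S : Finset (HeightOneSpectrum (𝓞 ℚ)))
    (hS : ∀ v ∈ S, (p : 𝓞 ℚ) ∉ v.asIdeal →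
      (primesEquiv v : ℕ) ≠ p ∧ ¬ p ∣ (W.baseChange (v.adicCompletion ℚ)).localTamagawaNumber
        (v.adicCompletionIntegers ℚ) * reductionPointCount W (primesEquiv v : ℕ))
    (hgood : ∀ v ∉ S, (p : 𝓞 ℚ) ∉ v.asIdeal ∧ W.HasGoodReductionAt v)
    (Dh : PAdicHeightData W p) (hlow : CycLowerBoundAt W p Dh) : BSDp W p :=
  X4RankZero.bsdp_of_facts_of_lower W p hKatoS hDel98 hGZK hmod hmodD hL20 hKatoχ hr hX.1 hsurj hcov
    (ClassX4Gord.missingLowerBoundAt_rankZero_of_cycLowerBound_allNumeric hX hGZK hr S hS hgood Dh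
      hlow)

/-- **X4♯(G-ord), `r_an = 0`, `ρ̄_{E,p}` onto, `p ≥ 5`, `p ∤ ∏ c_ℓ`: `BSD(E,p)` from PRINTED facts
(Kato 14.5 (3) Manin-free reading `hKatoMF`, Delbourgo 1998 Prop. 4 `hDel98`, GZK, modularity `hmod` /
`hmodD`, Wuthrich–Kato `ω^{(p−1)/2}`-component `hKatoχ`), census place data, `p ∤ ∏ c_ℓ` (census
column) and the ONE typed input `CycLowerBoundAt W p Dh`** — the upper half is additive-p4's
`X4RankZero.missingUpperBoundAt_of_facts_of_five_le_maninFree` (no tower certificate, no Manin datum at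
`p ≥ 5`), the lower half is FILE 2's `ClassX4Gord.missingLowerBoundAt_rankZero_of_cycLowerBound`
(NO Delbourgo 2002, NO Schneider, NO `¬CM`, NO `hna`). X4 stays CONSTRUCTION-SHAPED; nothing booked.
[cite: Kato2004Asterisque, Thm. 14.5 (3) (p. 236)] [cite: Delbourgo1998, Prop. 4 (p. 144)]
[cite: GreenbergLNM1716, §3 Prop. 3.8 (pp. 95–96) and §4 Thm. 4.1 (pp. 102–104)] [cite: Miller2011LMS, Def. 1.1] -/
theorem ClassX4Gord.bsdp_rankZero_of_factsManinFree_of_cycLowerBound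
    (hKatoMF : Kato2004.rankZero_padicValNat_sha_le_sub_localTamagawa_of_additive_potGood_of_imageContainsSL2_maninFree)
    (hDel98 : Delbourgo1998.prop4_rankZero_pow_dvd_constantCoeff)
    (hGZK : rank_eq_analyticRank_of_analyticRank_le_one) (hmod : hasEntireLFunction_rat)
    (hmodD : nonempty_modularParametrizationData)
    (hKatoχ : Wuthrich2014.kato_halfEigenCharIdeal_dvd_cyclotomicPrime_of_surjective)
    (hX : ClassX4Gord W p) (hp5 : 5 ≤ p) (hr : W.analyticRank = 0) (hsurj : Surj W p)
    (htam : ¬ p ∣ W.tamagawaProduct) (S : Finset (HeightOneSpectrum (𝓞 ℚ)))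
    (hS : ∀ v ∈ S, (p : 𝓞 ℚ) ∉ v.asIdeal → W.HasAdditiveReductionAt v ∨
      ((primesEquiv v : ℕ) ≠ p ∧ ¬ p ∣ (W.baseChange (v.adicCompletion ℚ)).localTamagawaNumber
        (v.adicCompletionIntegers ℚ) * reductionPointCount W (primesEquiv v : ℕ)))
    (hgood : ∀ v ∉ S, (p : 𝓞 ℚ) ∉ v.asIdeal ∧ W.HasGoodReductionAt v)
    (Dh : PAdicHeightData W p) (hlow : CycLowerBoundAt W p Dh) : BSDp W p :=
  bsdp_of_missingPPartAt W p hGZK (by rw [hr]; exact zero_le_one)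
    (missingPPartAt_of_lower_of_upper W p
      (ClassX4Gord.missingLowerBoundAt_rankZero_of_cycLowerBound hX hp5 hGZK hr S hS hgood Dh hlow)
      (X4RankZero.missingUpperBoundAt_of_facts_of_five_le_maninFree W p hKatoMF hDel98 hGZK hmod hmodD
        hKatoχ hp5 hr hX.1 hsurj (Or.inr htam)))

/-! ### The (M) twins: the `v ∋ p` socket is p12's T-T3M F4-M (mod the PUBLISHED Tate uniformisation A41) -/

/-- **X4(M) (additive potentially MULTIPLICATIVE at `p`, `E[p]` irreducible), rank `0`, EVERY `p ≥ 5`: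
the lower half from the typed input `CycLowerBoundAt W p Dh` by control alone, modulo A41 only.**
Sockets: `v ∋ p` by p12's T-T3M `AdditivePotMult.ClassX4M.localTowerKerPrimary_zero_eq_bot (hT41)`
(Delbourgo 1998 §2.2 Lemma (ii), re-proved; any `ℤ_p`-extension), additive `v ∤ p` free (`p ≥ 5`),
the other bad places by the numeric test; `p ∤ #tors` is `Irr`. NO Delbourgo 2002, NO Schneider, NO
`¬CM`, NO `hna`. X4(M) stays CONSTRUCTION-SHAPED (the typed input is OPEN); nothing booked.
[cite: SilvermanATAEC1994, Ch. V Thm. 5.3, Cor. 5.4] [cite: Delbourgo1998, §2.2 Lemma (ii) (p. 139)]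
[cite: GreenbergLNM1716, §3 Prop. 3.8 (pp. 95–96) and §4 Thm. 4.1 (pp. 102–104)] [cite: Miller2011LMS, Def. 1.1] -/
theorem ClassX4M.missingLowerBoundAt_rankZero_of_cycLowerBound
    (hT41 : Silverman1994_thmV53_corV54_tateUniformisation.{0})
    (hX : AdditivePotMult.ClassX4M W p) (hp5 : 5 ≤ p)
    (hGZK : rank_eq_analyticRank_of_analyticRank_le_one) (hr : W.analyticRank = 0)
    (S : Finset (HeightOneSpectrum (𝓞 ℚ)))
    (hS : ∀ v ∈ S, (p : 𝓞 ℚ) ∉ v.asIdeal → W.HasAdditiveReductionAt v ∨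
      ((primesEquiv v : ℕ) ≠ p ∧ ¬ p ∣ (W.baseChange (v.adicCompletion ℚ)).localTamagawaNumber
        (v.adicCompletionIntegers ℚ) * reductionPointCount W (primesEquiv v : ℕ)))
    (hgood : ∀ v ∉ S, (p : 𝓞 ℚ) ∉ v.asIdeal ∧ W.HasGoodReductionAt v)
    (Dh : PAdicHeightData W p) (hlow : CycLowerBoundAt W p Dh) :
    MissingLowerBoundAt W p :=
  missingLowerBoundAt_rankZero_of_cycLowerBound_of_numeric W p hp5 hGZK hr
    (Supersingular.not_dvd_torsionOrder_of_irr W p hX.irr) S hS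
    (fun κ _ _ hpv ↦ AdditivePotMult.ClassX4M.localTowerKerPrimary_zero_eq_bot hT41 hX hpv κ) hgood Dh
    hlow

/-- **X4(M), rank `0`, EVERY odd `p` (incl. `p = 3` — the 34 (M) @ 3 demand rows' currency), all bad
places away from `p` by the numeric test: the lower half from the typed input by control alone, mod A41.**
Nothing booked. [cite: SilvermanATAEC1994, Ch. V Thm. 5.3, Cor. 5.4] [cite: Delbourgo1998, §2.2 Lemma (ii) (p. 139)]
[cite: GreenbergLNM1716, §3 Prop. 3.8 (pp. 95–96) and §4 Thm. 4.1 (pp. 102–104)] [cite: Miller2011LMS, Def. 1.1] -/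
theorem ClassX4M.missingLowerBoundAt_rankZero_of_cycLowerBound_allNumeric
    (hT41 : Silverman1994_thmV53_corV54_tateUniformisation.{0})
    (hX : AdditivePotMult.ClassX4M W p)
    (hGZK : rank_eq_analyticRank_of_analyticRank_le_one) (hr : W.analyticRank = 0)
    (S : Finset (HeightOneSpectrum (𝓞 ℚ)))
    (hS : ∀ v ∈ S, (p : 𝓞 ℚ) ∉ v.asIdeal →
      (primesEquiv v : ℕ) ≠ p ∧ ¬ p ∣ (W.baseChange (v.adicCompletion ℚ)).localTamagawaNumber
        (v.adicCompletionIntegers ℚ) * reductionPointCount W (primesEquiv v : ℕ))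
    (hgood : ∀ v ∉ S, (p : 𝓞 ℚ) ∉ v.asIdeal ∧ W.HasGoodReductionAt v)
    (Dh : PAdicHeightData W p) (hlow : CycLowerBoundAt W p Dh) :
    MissingLowerBoundAt W p :=
  missingLowerBoundAt_rankZero_of_cycLowerBound_of_allNumeric W p hGZK hr
    (Supersingular.not_dvd_torsionOrder_of_irr W p hX.irr) S hS
    (fun κ _ _ hpv ↦ AdditivePotMult.ClassX4M.localTowerKerPrimary_zero_eq_bot hT41 hX hpv κ) hgood Dh
    hlow

/-- **X3♯(M), rank `0`, EVERY odd `p`, `p ∤ #E(ℚ)_tors` explicit, all bad places away from `p` numeric: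
the lower half from the typed input by control alone, mod A41.** Nothing booked.
[cite: SilvermanATAEC1994, Ch. V Thm. 5.3, Cor. 5.4] [cite: GreenbergLNM1716, §3 Prop. 3.8 (pp. 95–96) and §4 Thm. 4.1 (pp. 102–104)]
[cite: Miller2011LMS, Def. 1.1] -/
theorem ClassX3M.missingLowerBoundAt_rankZero_of_cycLowerBound_allNumeric
    (hT41 : Silverman1994_thmV53_corV54_tateUniformisation.{0})
    (hX : AdditivePotMult.ClassX3M W p)
    (hGZK : rank_eq_analyticRank_of_analyticRank_le_one) (hr : W.analyticRank = 0)
    (htors : ¬ p ∣ W.torsionOrder) (S : Finset (HeightOneSpectrum (𝓞 ℚ)))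
    (hS : ∀ v ∈ S, (p : 𝓞 ℚ) ∉ v.asIdeal →
      (primesEquiv v : ℕ) ≠ p ∧ ¬ p ∣ (W.baseChange (v.adicCompletion ℚ)).localTamagawaNumber
        (v.adicCompletionIntegers ℚ) * reductionPointCount W (primesEquiv v : ℕ))
    (hgood : ∀ v ∉ S, (p : 𝓞 ℚ) ∉ v.asIdeal ∧ W.HasGoodReductionAt v)
    (Dh : PAdicHeightData W p) (hlow : CycLowerBoundAt W p Dh) :
    MissingLowerBoundAt W p :=
  missingLowerBoundAt_rankZero_of_cycLowerBound_of_allNumeric W p hGZK hr htors S hS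
    (fun κ _ _ hpv ↦ AdditivePotMult.ClassX3M.localTowerKerPrimary_zero_eq_bot hT41 hX hpv κ) hgood Dh
    hlow

/-- **X4(M), `r_an = 0`, `ρ̄_{E,p}` onto, EVERY odd `p`: `BSD(E,p)` from PRINTED facts (Delbourgo 1998
Prop. 4 `hDel98`, GZK, modularity, Wuthrich Lemma 20 / Kato `ω^{(p−1)/2}`-component, Tate A41), census
place data and the ONE typed input `CycLowerBoundAt W p Dh`** — upper half =
`AdditivePotMult.ClassX4M.missingUpperBoundAt_rankZero_of_surj` (kernel theorem class-wide), lower half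
= this file's (M) twin. X4(M) stays CONSTRUCTION-SHAPED; nothing booked.
[cite: Delbourgo1998, Prop. 4 (p. 144)] [cite: SilvermanATAEC1994, Ch. V Thm. 5.3, Cor. 5.4]
[cite: GreenbergLNM1716, §3 Prop. 3.8 (pp. 95–96) and §4 Thm. 4.1 (pp. 102–104)] [cite: Miller2011LMS, Def. 1.1] -/
theorem ClassX4M.bsdp_rankZero_of_facts_of_cycLowerBound
    (hT41 : Silverman1994_thmV53_corV54_tateUniformisation.{0})
    (hDel98 : Delbourgo1998.prop4_rankZero_pow_dvd_constantCoeff)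
    (hGZK : rank_eq_analyticRank_of_analyticRank_le_one) (hmod : hasEntireLFunction_rat)
    (hmodD : nonempty_modularParametrizationData)
    (hL20 : Wuthrich2014.lemma20_surjective_threeAdic_of_semistable)
    (hKato : Wuthrich2014.kato_halfEigenCharIdeal_dvd_cyclotomicPrime_of_surjective)
    (hX : AdditivePotMult.ClassX4M W p) (hr : W.analyticRank = 0) (hsurj : Surj W p)
    (S : Finset (HeightOneSpectrum (𝓞 ℚ)))
    (hS : ∀ v ∈ S, (p : 𝓞 ℚ) ∉ v.asIdeal →
      (primesEquiv v : ℕ) ≠ p ∧ ¬ p ∣ (W.baseChange (v.adicCompletion ℚ)).localTamagawaNumber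
        (v.adicCompletionIntegers ℚ) * reductionPointCount W (primesEquiv v : ℕ))
    (hgood : ∀ v ∉ S, (p : 𝓞 ℚ) ∉ v.asIdeal ∧ W.HasGoodReductionAt v)
    (Dh : PAdicHeightData W p) (hlow : CycLowerBoundAt W p Dh) : BSDp W p :=
  bsdp_of_missingPPartAt W p hGZK (by rw [hr]; exact zero_le_one)
    (missingPPartAt_of_lower_of_upper W p
      (ClassX4M.missingLowerBoundAt_rankZero_of_cycLowerBound_allNumeric hT41 hX hGZK hr S hS hgood Dh
        hlow)
      (AdditivePotMult.ClassX4M.missingUpperBoundAt_rankZero_of_surj hDel98 hGZK hmod hmodD hL20 hKato hX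
        hr hsurj))

end Summit.BirchSwinnertonDyer.Rank1Residual.Additive

end
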